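/-
Copyright (c) 2026 the pub-hodgecm-mathlib formalisation cell (harness21).  Prover seat hodgecm-mathlib-K2E1-p11 (g4), Track B ∕ K2-LIT, h413 = `stmt-HodgeConjecture-24833`,
R90-TF section S8 «ContSpec-n½», #2 road (G side), S8 dealer R90-CS-plan (g3) S8-R151 (1), FILE 3a of the census `R90/S8/CENSUS-ChiSectionPairArchSection.K2E1-p11-g4.md` 3c6bbbb28138e070:
the MULTIPLIER ALGEBRA of the archimedean last-row section — `Θ` (★ p863552 `lastRowChar`) is multiplicative on ideles, and for an upper-triangular `b ∈ B(𝔸) ≤ U(J₃)(𝔸)`: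
`c•b₂₂ = b₀₀⁻¹`, `det b = b₀₀b₁₁b₂₂`, the last row of `b·g` is `b₂₂·(last row of g)`, whence `Θ(b₂₂·y)·χ₂⟨det(b g)⟩ = χ₁(b₀₀)·χ₂⟨b₁₁⟩·Θ(y)·χ₂⟨det g⟩`.
-/
import Summits.HodgeConjecture.HodgeConjecture.Theorems.R90S8ChiSectionPairArchSectionU3Defs   -- ★ p863552 (this seat): `idelePhase`, `lastRowChar`, `archSection`; brings ★ `adelicDet`, `adelicOneChar`, ★ FILE 2 §0, `diagEntryUnit`, `conjAdele_diag_mul_diag_rev`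
import HarnessLib

/-!
# S8 #2 road (G side) — `R90S8ChiSectionPairArchSectionAlgebraU3`: the multiplier algebra of the archimedean last-row section — `Θ(XY) = Θ(X)Θ(Y)`; for `b ∈ B(𝔸) ≤ U(J₃)(𝔸_{L⁺})`:
# `c•b₂₂·b₀₀ = 1`, `det b = b₀₀ b₁₁ b₂₂`, `(b g)₂ⱼ = b₂₂ g₂ⱼ`, and **`Θ(b₂₂ y)·χ₂⟨det(bg)⟩ = χ₁(b₀₀)·χ₂⟨b₁₁⟩·(Θ(y)·χ₂⟨det g⟩)`**

Track B ∕ K2-LIT, crux h413 = `stmt-HodgeConjecture-24833`, route of record `HCCMUnconditional`; cell `hodgecm-mathlib`, R90-TF programme, section S8 «ContSpec-n½», socket (V)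
`sock_S8_res_midBlock_ne_bot` (`Lines/R90_S8_ResidualSpectrumU3B.lean` :300), discharge-table row (i) «non-zero section witness».  THEOREMS ONLY (no `def`, no `instance`, no `notation`,
no named-fact hypothesis, no `sorry`; default heartbeats); lane `--supports stmt-HodgeConjecture-24833 --as helper` (count-neutral).  CLOSES NO SOCKET: it is the algebraic half of the letter
`hΦaB` of ★ p863433 (FILE 1) for the section ★ p863552 `archSection` (the continuity half `hΦac` and the assembly are files 3b∕3c); the identities hold for EVERY adele `y` in place of the
last-row entry, so they serve the `x₂`-version of ★ p863552 and the `V₋`-functional version `ℓ = x₂ − x₀` of K2E1-p13's census 5675c523d85af6df alike.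

THE MATHEMATICS ([Rogawski1990, §1.9–§1.10]; [BorelJacquet1979, §4.1]).  `Θ(X) = χ₁((c•X)⁻¹)·χ₂⟨(c•X)X⁻¹⟩` is a product of two characters of `𝔸_Lˣ` (`X ↦ (c•X)X⁻¹ ∈ U(1)(𝔸)` is a
homomorphism into a commutative group), hence multiplicative (§1).  For `b ∈ B(𝔸)` with diagonal ideles `d_i = b_ii` (★ `diagEntryUnit`): unitarity `ᵗ(c•b)J₃b = J₃` read at `(2, 0)` gives
`c•d₂ · d₀ = 1` (★ `conjAdele_diag_mul_diag_rev hb 2`), so `Θ(d₂) = χ₁(d₀)·χ₂⟨(d₀d₂)⁻¹⟩` with `d₀d₂ ∈ U(1)(𝔸)`; `det b = d₀d₁d₂` (Mathlib `Matrix.det_of_upperTriangular`), so in `U(1)(𝔸)`: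
`⟨det b⟩ = ⟨d₁⟩·⟨d₀d₂⟩` and `χ₂⟨det b⟩·χ₂⟨(d₀d₂)⁻¹⟩ = χ₂⟨d₁⟩ = χ₂(b₁₁)` (★ `middleEntryUnitary` = `⟨d₁⟩` read in the torus, `rfl`); finally `(bg)₂ⱼ = Σ_k b₂ₖ g_kⱼ = d₂ g₂ⱼ`
(`b₂₀ = b₂₁ = 0`).  §3 assembles: `Θ(d₂ y)·χ₂⟨det(bg)⟩ = χ₁(d₀)χ₂(b₁₁)·Θ(y)·χ₂⟨det g⟩` — the multiplier is EXACTLY `χ₁(firstEntryUnit hb)·χ₂(middleEntryUnitary hb)`.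
* §1 `idelePhase_mul`, `lastRowChar_coe_units`, **`lastRowChar_units_mul`**, `lastRowChar_one`, `lastRowChar_mul_of_not_isUnit`.
* §2 `conjAdele_diagEntryUnit_two_mul_zero` (`c•d₂·d₀ = 1`), `units_map_conjAdele_diagEntryUnit_two` (`c•d₂ = d₀⁻¹` in `𝔸_Lˣ`), `diagEntryUnit_zero_mul_two_mem_adelicOne`, `idelePhase_diagEntryUnit_two`,
  **`lastRowChar_diagEntryUnit_two`** (`Θ(d₂) = χ₁(d₀)·χ₂⟨(d₀d₂)⁻¹⟩`), `det_eq_prod_diagEntryUnit` (`det b = d₀d₁d₂`), **`adelicOneChar_adelicDet_borel`** (`χ₂⟨det b⟩ = χ₂(b₁₁)·χ₂⟨d₀d₂⟩`),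
  `lastRow_borel_mul` (`(bg)₂ⱼ = d₂·g₂ⱼ`).
* §3 **`lastRowChar_borel_mul_mul_adelicDet`** — THE MULTIPLIER LEMMA.
HONEST LABEL: HC_CM is proved only modulo the 7 printed citations (2 remaining named inputs: hLiu418 = `stmt-HodgeConjecture-24832`, h413 = `stmt-HodgeConjecture-24833`) until rung 0
closes; REL ≠ ★ ≠ BUILT; this file asserts no named fact and closes no socket; count-neutral.

## References
* [Rogawski1990] J. D. Rogawski, *Automorphic Representations of Unitary Groups in Three Variables* (1990), §1.9–§1.10.
* [BorelJacquet1979] A. Borel, H. Jacquet, *Automorphic forms and automorphic representations*, Corvallis PSPM 33.1 (1979), §4.1.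
-/

set_option autoImplicit false
set_option linter.dupNamespace false  -- the mandated namespace `…HodgeConjecture.HodgeConjecture.R90.S8` (LEAD #1 L1) repeats the summit's segment

noncomputable section

open NumberField Topology
open Literature.NumberTheory.Automorphic Literature.NumberTheory.Automorphic.UnitaryGroup Literature.NumberTheory.GaloisRepresentations AdelicGroupData
open Literature.NumberTheory.Automorphic.Arthur2013.Leaves.TECR
open Literature.NumberTheory.Automorphic.UnitaryGroup.AdelicCharactersDetQuasiSplit (antidiagonal_over_det_ne_zero)
open Summit.HodgeConjecture.HodgeConjecture.Cruxes.H413.K2E1CharacterEisensteinU2Defs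
open Summit.HodgeConjecture.HodgeConjecture.Cruxes.H413.K2E1CharacterEisensteinU3PairDefs

namespace Summit.HodgeConjecture.HodgeConjecture.R90.S8

variable (L : Type) [Field L] [NumberField L] [IsCMField L]

/-! ## §1 `Θ` is multiplicative on ideles -/

/-- The unit phase is multiplicative: `⟨c•(XY)(XY)⁻¹⟩ = ⟨(c•X)X⁻¹⟩·⟨(c•Y)Y⁻¹⟩` (`𝔸_Lˣ` is commutative). [cite: Rogawski1990, §1.9] -/
theorem idelePhase_mul (X Y : (AdeleRing (𝓞 L) L)ˣ) : idelePhase L (X * Y) = idelePhase L X * idelePhase L Y := by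
  refine Subtype.ext ?_
  show Units.map (conjAdele (↥(maximalRealSubfield L)) L (IsCMField.complexConj L) : AdeleRing (𝓞 L) L →* AdeleRing (𝓞 L) L) (X * Y) * (X * Y)⁻¹ =
    (Units.map (conjAdele (↥(maximalRealSubfield L)) L (IsCMField.complexConj L) : AdeleRing (𝓞 L) L →* AdeleRing (𝓞 L) L) X * X⁻¹) *
      (Units.map (conjAdele (↥(maximalRealSubfield L)) L (IsCMField.complexConj L) : AdeleRing (𝓞 L) L →* AdeleRing (𝓞 L) L) Y * Y⁻¹)
  rw [map_mul, mul_inv]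
  exact mul_mul_mul_comm _ _ _ _

/-- **`Θ` on an idele `X`**: `Θ(X) = χ₁((c•X)⁻¹)·χ₂⟨(c•X)X⁻¹⟩` (★ `lastRowChar_of_isUnit` with `(IsUnit X).unit = X`). [cite: Rogawski1990, §1.10] -/
theorem lastRowChar_coe_units (χ₁ : HeckeCharacter L) (χ₂ : ↥(TorusDict.torus (IsCMField.complexConj L)) →ₜ* ℂˣ) (X : (AdeleRing (𝓞 L) L)ˣ) :
    lastRowChar L χ₁ χ₂ (X : AdeleRing (𝓞 L) L) =
      ((χ₁ (Units.map (conjAdele (↥(maximalRealSubfield L)) L (IsCMField.complexConj L) : AdeleRing (𝓞 L) L →* AdeleRing (𝓞 L) L) X)⁻¹ : ℂˣ) : ℂ) *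
        ((adelicOneChar (↥(maximalRealSubfield L)) L (IsCMField.complexConj L) χ₂ (idelePhase L X) : ℂˣ) : ℂ) := by
  rw [lastRowChar_of_isUnit L χ₁ χ₂ (Units.isUnit X), IsUnit.unit_of_val_units]

/-- **`Θ(XY) = Θ(X)·Θ(Y)`** on ideles. [cite: Rogawski1990, §1.10] -/
theorem lastRowChar_units_mul (χ₁ : HeckeCharacter L) (χ₂ : ↥(TorusDict.torus (IsCMField.complexConj L)) →ₜ* ℂˣ) (X Y : (AdeleRing (𝓞 L) L)ˣ) :
    lastRowChar L χ₁ χ₂ ((X * Y : (AdeleRing (𝓞 L) L)ˣ) : AdeleRing (𝓞 L) L) = lastRowChar L χ₁ χ₂ (X : AdeleRing (𝓞 L) L) * lastRowChar L χ₁ χ₂ (Y : AdeleRing (𝓞 L) L) := by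
  rw [lastRowChar_coe_units, lastRowChar_coe_units, lastRowChar_coe_units, map_mul, mul_inv, map_mul, idelePhase_mul, map_mul, Units.val_mul, Units.val_mul]
  ring

/-- `Θ(1) = 1`. [folklore] -/
theorem lastRowChar_one (χ₁ : HeckeCharacter L) (χ₂ : ↥(TorusDict.torus (IsCMField.complexConj L)) →ₜ* ℂˣ) : lastRowChar L χ₁ χ₂ 1 = 1 := by
  have h1 : idelePhase L 1 = 1 := Subtype.ext (by rw [coe_idelePhase, map_one, inv_one, mul_one]; rfl)
  rw [← Units.val_one, lastRowChar_coe_units, map_one, inv_one, map_one, h1, map_one]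
  simp

/-- `Θ(X·y) = 0 = Θ(y)·(anything)` when `y` is not a unit (then neither is `X·y`). [folklore] -/
theorem lastRowChar_mul_of_not_isUnit (χ₁ : HeckeCharacter L) (χ₂ : ↥(TorusDict.torus (IsCMField.complexConj L)) →ₜ* ℂˣ) (X : (AdeleRing (𝓞 L) L)ˣ) {y : AdeleRing (𝓞 L) L} (hy : ¬ IsUnit y) :
    lastRowChar L χ₁ χ₂ ((X : AdeleRing (𝓞 L) L) * y) = 0 := by
  refine lastRowChar_of_not_isUnit L χ₁ χ₂ (fun h => hy ?_)
  have h' : IsUnit (((X⁻¹ : (AdeleRing (𝓞 L) L)ˣ) : AdeleRing (𝓞 L) L) * ((X : AdeleRing (𝓞 L) L) * y)) := (Units.isUnit X⁻¹).mul h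
  rwa [← mul_assoc, Units.inv_mul, one_mul] at h'

/-! ## §2 The diagonal of `b ∈ B(𝔸) ≤ U(J₃)(𝔸_{L⁺})`: `c•d₂ = d₀⁻¹`, `Θ(d₂)`, `det b = d₀d₁d₂`, `χ₂⟨det b⟩`, the last row of `b·g` -/

/-- **`c•b₂₂ · b₀₀ = 1`**: the `(2,0)` entry of `ᵗ(c•b) J₃ b = J₃` (★ `conjAdele_diag_mul_diag_rev hb 2`, `rev 2 = 0`). [cite: Rogawski1990, §1.9 p. 8] -/
theorem conjAdele_diagEntryUnit_two_mul_zero {b : (quasiSplit (↥(maximalRealSubfield L)) L (IsCMField.complexConj L) 3).Adelic} (hb : b ∈ borelAdelic (↥(maximalRealSubfield L)) L (IsCMField.complexConj L) 3) :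
    conjAdele (↥(maximalRealSubfield L)) L (IsCMField.complexConj L) (diagEntryUnit hb 2 : AdeleRing (𝓞 L) L) * (diagEntryUnit hb 0 : AdeleRing (𝓞 L) L) = 1 :=
  conjAdele_diagEntryUnit_mul_diagEntryUnit_rev hb 2

/-- `c•d₂ = d₀⁻¹` in `𝔸_Lˣ`. [cite: Rogawski1990, §1.9 p. 8] -/
theorem units_map_conjAdele_diagEntryUnit_two {b : (quasiSplit (↥(maximalRealSubfield L)) L (IsCMField.complexConj L) 3).Adelic} (hb : b ∈ borelAdelic (↥(maximalRealSubfield L)) L (IsCMField.complexConj L) 3) :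
    Units.map (conjAdele (↥(maximalRealSubfield L)) L (IsCMField.complexConj L) : AdeleRing (𝓞 L) L →* AdeleRing (𝓞 L) L) (diagEntryUnit hb 2) = (diagEntryUnit hb 0)⁻¹ :=
  eq_inv_of_mul_eq_one_left (Units.ext (by rw [Units.val_mul, Units.coe_map, MonoidHom.coe_coe]; exact conjAdele_diagEntryUnit_two_mul_zero L hb))

/-- `d₀·d₂ ∈ U(1)(𝔸)` (`c•(d₀d₂)·d₀d₂ = (c•d₀·d₂)(c•d₂·d₀) = 1`). [cite: Rogawski1990, §1.9 p. 8] -/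
theorem diagEntryUnit_zero_mul_two_mem_adelicOne {b : (quasiSplit (↥(maximalRealSubfield L)) L (IsCMField.complexConj L) 3).Adelic} (hb : b ∈ borelAdelic (↥(maximalRealSubfield L)) L (IsCMField.complexConj L) 3) :
    diagEntryUnit hb 0 * diagEntryUnit hb 2 ∈ adelicOne (↥(maximalRealSubfield L)) L (IsCMField.complexConj L) := by
  rw [mem_adelicOne_iff, Units.val_mul, map_mul]
  have h0 : conjAdele (↥(maximalRealSubfield L)) L (IsCMField.complexConj L) (diagEntryUnit hb 0 : AdeleRing (𝓞 L) L) * (diagEntryUnit hb 2 : AdeleRing (𝓞 L) L) = 1 :=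
    conjAdele_diagEntryUnit_mul_diagEntryUnit_rev hb 0
  have h2 := conjAdele_diagEntryUnit_two_mul_zero L hb
  calc conjAdele (↥(maximalRealSubfield L)) L (IsCMField.complexConj L) (diagEntryUnit hb 0 : AdeleRing (𝓞 L) L) * conjAdele (↥(maximalRealSubfield L)) L (IsCMField.complexConj L) (diagEntryUnit hb 2 : AdeleRing (𝓞 L) L) *
        ((diagEntryUnit hb 0 : AdeleRing (𝓞 L) L) * (diagEntryUnit hb 2 : AdeleRing (𝓞 L) L))
      = (conjAdele (↥(maximalRealSubfield L)) L (IsCMField.complexConj L) (diagEntryUnit hb 0 : AdeleRing (𝓞 L) L) * (diagEntryUnit hb 2 : AdeleRing (𝓞 L) L)) *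
          (conjAdele (↥(maximalRealSubfield L)) L (IsCMField.complexConj L) (diagEntryUnit hb 2 : AdeleRing (𝓞 L) L) * (diagEntryUnit hb 0 : AdeleRing (𝓞 L) L)) := by ring
    _ = 1 := by rw [h0, h2, mul_one]

/-- The phase of `d₂`: `⟨(c•d₂)d₂⁻¹⟩ = ⟨d₀d₂⟩⁻¹` in `U(1)(𝔸)`. [cite: Rogawski1990, §1.9 p. 8] -/
theorem idelePhase_diagEntryUnit_two {b : (quasiSplit (↥(maximalRealSubfield L)) L (IsCMField.complexConj L) 3).Adelic} (hb : b ∈ borelAdelic (↥(maximalRealSubfield L)) L (IsCMField.complexConj L) 3) :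
    idelePhase L (diagEntryUnit hb 2) = (⟨diagEntryUnit hb 0 * diagEntryUnit hb 2, diagEntryUnit_zero_mul_two_mem_adelicOne L hb⟩ : ↥(adelicOne (↥(maximalRealSubfield L)) L (IsCMField.complexConj L)))⁻¹ := by
  refine Subtype.ext ?_
  show Units.map (conjAdele (↥(maximalRealSubfield L)) L (IsCMField.complexConj L) : AdeleRing (𝓞 L) L →* AdeleRing (𝓞 L) L) (diagEntryUnit hb 2) * (diagEntryUnit hb 2)⁻¹ =
    (diagEntryUnit hb 0 * diagEntryUnit hb 2)⁻¹
  rw [units_map_conjAdele_diagEntryUnit_two L hb, mul_inv]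

/-- **`Θ(d₂) = χ₁(d₀) · χ₂⟨d₀d₂⟩⁻¹`** for `b ∈ B(𝔸)`. [cite: Rogawski1990, §1.10] -/
theorem lastRowChar_diagEntryUnit_two (χ₁ : HeckeCharacter L) (χ₂ : ↥(TorusDict.torus (IsCMField.complexConj L)) →ₜ* ℂˣ)
    {b : (quasiSplit (↥(maximalRealSubfield L)) L (IsCMField.complexConj L) 3).Adelic} (hb : b ∈ borelAdelic (↥(maximalRealSubfield L)) L (IsCMField.complexConj L) 3) :
    lastRowChar L χ₁ χ₂ (diagEntryUnit hb 2 : AdeleRing (𝓞 L) L) =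
      ((χ₁ (diagEntryUnit hb 0) : ℂˣ) : ℂ) *
        (((adelicOneChar (↥(maximalRealSubfield L)) L (IsCMField.complexConj L) χ₂
          ⟨diagEntryUnit hb 0 * diagEntryUnit hb 2, diagEntryUnit_zero_mul_two_mem_adelicOne L hb⟩)⁻¹ : ℂˣ) : ℂ) := by
  rw [lastRowChar_coe_units, units_map_conjAdele_diagEntryUnit_two L hb, inv_inv, idelePhase_diagEntryUnit_two L hb, map_inv]

/-- **`det b = d₀ d₁ d₂`** for `b ∈ B(𝔸)` (upper triangular: Mathlib `Matrix.det_of_upperTriangular`). [folklore] -/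
theorem det_eq_prod_diagEntryUnit {b : (quasiSplit (↥(maximalRealSubfield L)) L (IsCMField.complexConj L) 3).Adelic} (hb : b ∈ borelAdelic (↥(maximalRealSubfield L)) L (IsCMField.complexConj L) 3) :
    Matrix.GeneralLinearGroup.det (adelicVal (↥(maximalRealSubfield L)) L (IsCMField.complexConj L) 3 ((StdForm.antidiagonal 3).over L) b) = diagEntryUnit hb 0 * diagEntryUnit hb 1 * diagEntryUnit hb 2 := by
  refine Units.ext ?_
  rw [Matrix.GeneralLinearGroup.val_det_apply, Matrix.det_of_upperTriangular ((mem_borelAdelic_iff b).1 hb), Fin.prod_univ_three, Units.val_mul, Units.val_mul]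
  rfl

/-- **`χ₂⟨det b⟩ = χ₂(b₁₁) · χ₂⟨d₀d₂⟩`** for `b ∈ B(𝔸)` (`⟨det b⟩ = ⟨d₁⟩·⟨d₀d₂⟩` in `U(1)(𝔸)`; `⟨d₁⟩` read in the torus IS ★ `middleEntryUnitary hb`). [cite: Rogawski1990, §1.10 p. 9] -/
theorem adelicOneChar_adelicDet_borel (χ₂ : ↥(TorusDict.torus (IsCMField.complexConj L)) →ₜ* ℂˣ)
    {b : (quasiSplit (↥(maximalRealSubfield L)) L (IsCMField.complexConj L) 3).Adelic} (hb : b ∈ borelAdelic (↥(maximalRealSubfield L)) L (IsCMField.complexConj L) 3) :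
    adelicOneChar (↥(maximalRealSubfield L)) L (IsCMField.complexConj L) χ₂
        (adelicDet (↥(maximalRealSubfield L)) L (IsCMField.complexConj L) 3 ((StdForm.antidiagonal 3).over L) (antidiagonal_over_det_ne_zero L 3) b) =
      χ₂ (middleEntryUnitary hb) *
        adelicOneChar (↥(maximalRealSubfield L)) L (IsCMField.complexConj L) χ₂ ⟨diagEntryUnit hb 0 * diagEntryUnit hb 2, diagEntryUnit_zero_mul_two_mem_adelicOne L hb⟩ := by
  have hdet : adelicDet (↥(maximalRealSubfield L)) L (IsCMField.complexConj L) 3 ((StdForm.antidiagonal 3).over L) (antidiagonal_over_det_ne_zero L 3) b =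
      middleEntryOne hb * ⟨diagEntryUnit hb 0 * diagEntryUnit hb 2, diagEntryUnit_zero_mul_two_mem_adelicOne L hb⟩ := by
    refine Subtype.ext ?_
    show Matrix.GeneralLinearGroup.det (adelicVal (↥(maximalRealSubfield L)) L (IsCMField.complexConj L) 3 ((StdForm.antidiagonal 3).over L) b) = diagEntryUnit hb 1 * (diagEntryUnit hb 0 * diagEntryUnit hb 2)
    rw [det_eq_prod_diagEntryUnit L hb, mul_left_comm, mul_assoc]
  rw [hdet, map_mul]
  rfl

/-- **The last row of `b·g` is `b₂₂ ·` (the last row of `g`)** for `b ∈ B(𝔸)` (`b₂₀ = b₂₁ = 0`). [folklore] -/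
theorem lastRow_borel_mul {b : (quasiSplit (↥(maximalRealSubfield L)) L (IsCMField.complexConj L) 3).Adelic} (hb : b ∈ borelAdelic (↥(maximalRealSubfield L)) L (IsCMField.complexConj L) 3)
    (g : (quasiSplit (↥(maximalRealSubfield L)) L (IsCMField.complexConj L) 3).Adelic) (j : Fin 3) :
    ((adelicVal (↥(maximalRealSubfield L)) L (IsCMField.complexConj L) 3 ((StdForm.antidiagonal 3).over L) (b * g) : GL (Fin 3) (AdeleRing (𝓞 L) L)) : Matrix (Fin 3) (Fin 3) (AdeleRing (𝓞 L) L)) 2 j =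
      (diagEntryUnit hb 2 : AdeleRing (𝓞 L) L) *
        ((adelicVal (↥(maximalRealSubfield L)) L (IsCMField.complexConj L) 3 ((StdForm.antidiagonal 3).over L) g : GL (Fin 3) (AdeleRing (𝓞 L) L)) : Matrix (Fin 3) (Fin 3) (AdeleRing (𝓞 L) L)) 2 j := by
  have hT : (((adelicVal (↥(maximalRealSubfield L)) L (IsCMField.complexConj L) 3 ((StdForm.antidiagonal 3).over L) b : GL (Fin 3) (AdeleRing (𝓞 L) L)) : Matrix (Fin 3) (Fin 3) (AdeleRing (𝓞 L) L))).BlockTriangular id :=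
    (mem_borelAdelic_iff b).1 hb
  rw [map_mul, Units.val_mul, Matrix.mul_apply, Fin.sum_univ_three, hT (show ((0 : Fin 3) : Fin 3) < 2 by decide), hT (show ((1 : Fin 3) : Fin 3) < 2 by decide), zero_mul, zero_mul,
    zero_add, zero_add, coe_diagEntryUnit]

/-! ## §3 The multiplier lemma -/

/-- **THE MULTIPLIER LEMMA**: for `b ∈ B(𝔸) ≤ U(J₃)(𝔸_{L⁺})`, every `g` and every adele `y`,
`Θ(b₂₂·y) · χ₂⟨det(b g)⟩ = (χ₁(b₀₀) · χ₂(b₁₁)) · (Θ(y) · χ₂⟨det g⟩)` — the Borel pair character `χ₁(firstEntryUnit hb)·χ₂(middleEntryUnitary hb)` is EXACTLY the multiplier of the last-row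
section (§1 multiplicativity, §2 `Θ(d₂) = χ₁(d₀)χ₂⟨d₀d₂⟩⁻¹` and `χ₂⟨det b⟩ = χ₂(b₁₁)χ₂⟨d₀d₂⟩`; both sides vanish when `y` is not a unit).  Applied with `y :=` the last-row entry (or
functional) of `g = ι_∞ a` and `b := b_∞` it is the algebraic content of ★ p863433's letter `hΦaB`. [cite: Rogawski1990, §1.9–§1.10] [cite: BorelJacquet1979, §4.1] -/
theorem lastRowChar_borel_mul_mul_adelicDet (χ₁ : HeckeCharacter L) (χ₂ : ↥(TorusDict.torus (IsCMField.complexConj L)) →ₜ* ℂˣ)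
    {b : (quasiSplit (↥(maximalRealSubfield L)) L (IsCMField.complexConj L) 3).Adelic} (hb : b ∈ borelAdelic (↥(maximalRealSubfield L)) L (IsCMField.complexConj L) 3)
    (g : (quasiSplit (↥(maximalRealSubfield L)) L (IsCMField.complexConj L) 3).Adelic) (y : AdeleRing (𝓞 L) L) :
    lastRowChar L χ₁ χ₂ ((diagEntryUnit hb 2 : AdeleRing (𝓞 L) L) * y) *
        ((adelicOneChar (↥(maximalRealSubfield L)) L (IsCMField.complexConj L) χ₂
          (adelicDet (↥(maximalRealSubfield L)) L (IsCMField.complexConj L) 3 ((StdForm.antidiagonal 3).over L) (antidiagonal_over_det_ne_zero L 3) (b * g)) : ℂˣ) : ℂ) =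
      (((χ₁ (firstEntryUnit hb) : ℂˣ) : ℂ) * ((χ₂ (middleEntryUnitary hb) : ℂˣ) : ℂ)) *
        (lastRowChar L χ₁ χ₂ y *
          ((adelicOneChar (↥(maximalRealSubfield L)) L (IsCMField.complexConj L) χ₂
            (adelicDet (↥(maximalRealSubfield L)) L (IsCMField.complexConj L) 3 ((StdForm.antidiagonal 3).over L) (antidiagonal_over_det_ne_zero L 3) g) : ℂˣ) : ℂ)) := by
  rw [show adelicDet (↥(maximalRealSubfield L)) L (IsCMField.complexConj L) 3 ((StdForm.antidiagonal 3).over L) (antidiagonal_over_det_ne_zero L 3) (b * g) =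
      adelicDet (↥(maximalRealSubfield L)) L (IsCMField.complexConj L) 3 ((StdForm.antidiagonal 3).over L) (antidiagonal_over_det_ne_zero L 3) b *
        adelicDet (↥(maximalRealSubfield L)) L (IsCMField.complexConj L) 3 ((StdForm.antidiagonal 3).over L) (antidiagonal_over_det_ne_zero L 3) g from map_mul _ _ _,
    map_mul, adelicOneChar_adelicDet_borel L χ₂ hb, firstEntryUnit_eq_diagEntryUnit_zero]
  by_cases hy : IsUnit y
  · obtain ⟨Y, rfl⟩ := hy
    rw [← Units.val_mul, lastRowChar_units_mul, lastRowChar_diagEntryUnit_two L χ₁ χ₂ hb, Units.val_inv_eq_inv_val]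
    have hne : ((adelicOneChar (↥(maximalRealSubfield L)) L (IsCMField.complexConj L) χ₂
        ⟨diagEntryUnit hb 0 * diagEntryUnit hb 2, diagEntryUnit_zero_mul_two_mem_adelicOne L hb⟩ : ℂˣ) : ℂ) ≠ 0 := Units.ne_zero _
    push_cast
    field_simp
  · rw [lastRowChar_mul_of_not_isUnit L χ₁ χ₂ _ hy, lastRowChar_of_not_isUnit L χ₁ χ₂ hy, zero_mul, zero_mul, mul_zero]

end Summit.HodgeConjecture.HodgeConjecture.R90.S8

end
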